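import Literature.NumberTheory.Rogawski1990.Ch3Sec10to13PadicBridge
import Literature.NumberTheory.Rogawski1990.Ch3Sec13Prop3132Holds
import Literature.NumberTheory.Automorphic.LocalFieldHermitianClassification
import HarnessLib

/-!
# [Rogawski1990, §3.13] PROPOSITION 3.13.2 (a), `F` `p`-adic — the stable `ε`-class of an `ε`-semisimple, non-`ε`-regular `δ` with
# `N(δ)` non-central consists of TWO `ε`-classes modulo `F^*`: DISCHARGE of ★ `Ch3Sec10to13.prop3132aPadic`

J. D. Rogawski, *Automorphic Representations of Unitary Groups in Three Variables*, Ann. of Math. Stud. 123 (1990) [Rogawski1990],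
§3.13 p. 38 (held chunk p0042): «PROPOSITION 3.13.2: (a) If `N(δ)` is not central, `𝒟_ε(δ/F)` is naturally isomorphic to `F^*/NE^*`»,
read for `F` `p`-adic as the COUNT ★ `HasTwoClassesModF` (the carpet's ED. 3 letter ★ `prop3132aPadic`: exactly two `ε`-classes modulo
`F^*` in `𝒪_{ε-st}(δ)`; the printed proof derives (a) «from Proposition 3.11.2 (b) and (3.8.1)», whose injectivity is `p`-adic, p. 31).
Companion PROOF FILE (cell hodgecm-mathlib, seat B-typ01 (g34)) of the carpet ★ `Literature/NumberTheory/Rogawski1990/Ch3Sec10to13.lean`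
(after its ED. 5 «universe pin», `(F E : Type)`), twin of ★ `Ch3Sec13Prop3132bPadicHolds` (B-typ04 (g34), central `N(δ)`): it
discharges the named fact by `theorem prop3132aPadic_holds : prop3132aPadic F E σ Φ`.  THEOREMS ONLY (kernel-checked; no definition, no
named fact, no `sorry`, no instance, no notation); net debt −1.

THE PROOF (the print's cohomology made explicit as `σ`-SESQUILINEAR linear algebra; `Φ = Φ₃ = antidiag(1,−1,1)`, `ε(g) = Φ⁻¹ ᵗσ(g)⁻¹ Φ`
(★ `Ch4Sec10.unitaryTwist`), `N(g) = g ε(g)`, `A(g) := g Φ₃`).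
* §1–§2 THE DICTIONARY (as in the ★ `Prop3132b{Real,Padic}Holds` twins, reproduced privately): `ε`-conjugation `g ↦ y g ε(y)⁻¹` is the
  `σ`-CONGRUENCE `A ↦ y A ᵗσ(y)`; `N(g) = D ⟺ A(g) = D · ᵗσ(A(g))` (both directions); `N(y g ε(y)⁻¹) = y N(g) y⁻¹` (`ε ∘ ε = id`, ★
  `unitaryTwist_unitaryTwist`); `N(z g) = N(g)` for `z ∈ F^*` (★ `unitaryTwist_scalar`).
* §3 Hilbert 90 for `E¹` made explicit (`c = μ/σμ` with `μ = 1 + c` or `μ = θ − σθ`), and the two LOCAL INPUTS in topology-free form through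
  the `p`-adic bridge ★ `Ch3Sec10to13PadicBridge` (`IsPadicField F ∧ IsQuadraticConj F E σ` ⇒ `E` non-archimedean local): `[F^× : NE^×] = 2`
  (★ `exists_fixed_nonnorm_dichotomy_of_isPadicField`, from B-typ04's ★ `LocalFieldInvolutionNorm`) and JACOBOWITZ IN RANK 2 — two
  non-degenerate hermitian PLANES are congruent iff their discriminants differ by a norm (B-typ04's ★
  `UnitaryGroup.nonempty_formCongr_eq_iff_det_two_localField`, [Jacobowitz1962, Thm. 3.1]).
* §4 THE NORMAL FORM.  By ★ `prop3132_holds` the stable `ε`-class contains `d = d(a, b, a)`, `N(d) = D = d(α, β, α)` (★ `coe_epsNorm_diag`,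
  `α = a/σa`, `β = b/σb ∈ E¹`), and `α ≠ β` because `N(δ) ∼ D` is not central.  Every member `δ′` is `ε`-CONJUGATE to a `δ₁` with `N(δ₁) = D`
  exactly (conjugate `N(δ′)` to `D`); then `A = A(δ₁) = D ᵗσ(A)` reads `A_{ij} = D_i σ(A_{ji})`, so `A_{ij} = D_i σ(D_j) A_{ij}` kills the four
  entries linking the `α`-plane `{e₀, e₂}` to the `β`-line `{e₁}` (`ασ(β) = α/β ≠ 1`): `A = B ⊕ m` with `B = α ᵗσ(B) ∈ M₂(E)`, `m = β σ(m)`.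
  With `α = μ/σμ`, `β = ν/σν`: `B = μ H₂`, `H₂` HERMITIAN non-degenerate, and `m = ν h₁`, `h₁ ∈ F^×`.
* §5 THE COUNT.  Representatives `R(x) = d(μ, ν, μx) Φ₃` (`A(R(x)) = d(μ, ν, μx) = μ·d(1, x) ⊕ ν`, `N(R(x)) = D`) for `x = 1` and `x = t₀ ∉ NE^×`.
  EXHAUSTION: `Y := ᵗσ(U)` from Jacobowitz (`H₂ ≅ h₁·d(1, x)`, `x` chosen by the norm class of `disc H₂`) and `y = Y ⊕ 1` give
  `y A ᵗσ(y) = h₁ · A(R(x))`, i.e. `(yc) δ′ ε(yc)⁻¹ = (h₁·1) R(x)` — `ε`-conjugate MODULO `F^*`.  SEPARATION: `y R(1) ε(y)⁻¹ = (w·1) R(t₀)` forces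
  `y D y⁻¹ = D` (norms), so row `1` of `y` is `(0, y₁₁, 0)`; the `(1,1)` entry of `y A(R(1)) ᵗσ(y) = w A(R(t₀))` gives `w = y₁₁ σ(y₁₁)` — the
  `β`-LINE EATS ONE FACTOR `w` — and the determinant gives `N(det y) = w³ t₀`, whence `t₀ = N(det y / y₁₁³)`, a norm: contradiction.  (In odd
  rank the determinant alone does not separate: scaling by `w ∈ F^*` moves `disc` by `w³ ≡ w`; the invariant is the discriminant of the PLANE
  `H₂`, i.e. the hermitian line class of the print's `H_ξ`, p. 31.)
HONEST LABEL: HC_CM is proved only modulo the 7 printed citations (2 remaining named inputs: hLiu418 = stmt-HodgeConjecture-24832,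
h413 = stmt-HodgeConjecture-24833) until rung 0 closes; this file is off that cone, adds no citation debt (0 facts, 0 sorry) and discharges
1 named fact of ★ `Ch3Sec10to13` (net debt −1).

## References
* [Rogawski1990] §3.13 Prop. 3.13.2 (a) p. 38 (chunk p0042); §3.11 Prop. 3.11.2 (b) p. 36; §3.8 (3.8.1), Prop. 3.8.1 pp. 30–32; §3.10 p. 33; §1.9 p. 8.
* [Jacobowitz1962] R. Jacobowitz, *Hermitian forms over local fields*, Amer. J. Math. 84 (1962), §3 Thm. 3.1.
-/

noncomputable section

open scoped MatrixGroups
open scoped Matrix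

namespace Literature.NumberTheory.Rogawski1990.Ch3Sec10to13

open Literature.NumberTheory.Rogawski1990.Ch4Sec10 (unitaryTwist epsNorm IsEpsConj IsStablyEpsConj fixedScalarSubgroup)
open Literature.NumberTheory.GaloisRepresentations (glTransposeInv coe_glTransposeInv_apply)
open Literature.NumberTheory.Automorphic (formCongr)

/-! ## §1 The form `Φ₃ = antidiag(1, −1, 1)` -/

section Phi

/-- `Φ₃ = antidiag(1, −1, 1)` as a matrix literal. [cite: Rogawski1990, §1.9 p. 8 (chunk p0012)] -/
private theorem rogawskiPhi_three (R : Type) [CommRing R] :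
    rogawskiPhi R 3 = !![0, 0, 1; 0, -1, 0; 1, 0, 0] := by
  ext i j
  fin_cases i <;> fin_cases j <;> simp [rogawskiPhi]

/-- `Φ₃² = 1`. [folklore] -/
private theorem rogawskiPhi_three_mul_self (R : Type) [CommRing R] :
    rogawskiPhi R 3 * rogawskiPhi R 3 = 1 := by
  rw [rogawskiPhi_three]
  ext i j
  fin_cases i <;> fin_cases j <;> simp [Matrix.mul_apply, Fin.sum_univ_three]

/-- `ᵗf(Φ₃) = Φ₃`. [folklore] -/
private theorem rogawskiPhi_three_map_transpose {R S : Type} [CommRing R] [CommRing S] (f : R →+* S) :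
    ((rogawskiPhi R 3).map f)ᵀ = rogawskiPhi S 3 := by
  rw [rogawskiPhi_three, rogawskiPhi_three]
  ext i j
  fin_cases i <;> fin_cases j <;> simp

/-- `det Φ₃ ≠ 0` (indeed `Φ₃² = 1`). [folklore] -/
private theorem isUnit_det_rogawskiPhi_three (R : Type) [CommRing R] : IsUnit (rogawskiPhi R 3).det :=
  Matrix.isUnit_det_of_left_inverse (rogawskiPhi_three_mul_self R)

end Phi

/-! ## §2 The `ε`-calculus of `G̃ = GL₃(E)` for `Φ = Φ₃`: `A(g) = g Φ₃`, `ε`-conjugation = `σ`-congruence, `N(g) = A ᵗσ(A)⁻¹` -/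

section EpsCalculus

variable (F E : Type) [Field F] [Field E] [Algebra F E] [TopologicalSpace E] (σ : E ≃ₐ[F] E) (Φ : GL (Fin 3) E)

omit [TopologicalSpace E] in
/-- The entrywise image `σ(g)` as a matrix. [folklore] -/
private theorem coe_map_sigma_three (g : GL (Fin 3) E) :
    ((Matrix.GeneralLinearGroup.map (σ : E →+* E) g : GL (Fin 3) E) : Matrix (Fin 3) (Fin 3) E) =
      (g : Matrix (Fin 3) (Fin 3) E).map (σ : E →+* E) := rfl

omit [Algebra F E] [TopologicalSpace E] in
/-- The scalar `w · 1 ∈ GL₃(E)` as a matrix. [folklore] -/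
private theorem coe_scalar_three (w : Eˣ) :
    ((Matrix.GeneralLinearGroup.scalar (Fin 3) w : GL (Fin 3) E) : Matrix (Fin 3) (Fin 3) E) = (w : E) • (1 : Matrix (Fin 3) (Fin 3) E) := by
  rw [Matrix.GeneralLinearGroup.coe_scalar, Matrix.scalar_apply, Matrix.smul_one_eq_diagonal]

omit [Algebra F E] [TopologicalSpace E] in
/-- Scalars are central in `GL₃(E)`. [folklore] -/
private theorem scalar_mul_comm (w : Eˣ) (g : GL (Fin 3) E) :
    Matrix.GeneralLinearGroup.scalar (Fin 3) w * g = g * Matrix.GeneralLinearGroup.scalar (Fin 3) w := by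
  refine Units.ext ?_
  rw [Units.val_mul, Units.val_mul, coe_scalar_three, Matrix.smul_mul, Matrix.mul_smul, Matrix.one_mul, Matrix.mul_one]

omit [Algebra F E] [TopologicalSpace E] in
/-- The scalar matrix of a `σ`-fixed unit lies in `F^*` (★ `fixedScalarSubgroup`). [cite: Rogawski1990, §3.11 p. 35] -/
private theorem scalar_mem_fixedScalarSubgroup (τ : E →+* E) {w : Eˣ} (hw : τ (w : E) = w) :
    Matrix.GeneralLinearGroup.scalar (Fin 3) w ∈ fixedScalarSubgroup τ := by
  refine ⟨w, ?_, rfl⟩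
  show Units.map (τ : E →* E) w = MonoidHom.id Eˣ w
  exact Units.ext (by rw [Units.coe_map, MonoidHom.id_apply]; exact hw)

omit [Algebra F E] [TopologicalSpace E] in
/-- For `Φ = Φ₃`: `Φ⁻¹ = Φ₃` as a matrix (`Φ₃² = 1`). [folklore] -/
private theorem coe_phi_inv (hΦ : (Φ : Matrix (Fin 3) (Fin 3) E) = rogawskiPhi E 3) :
    ((Φ⁻¹ : GL (Fin 3) E) : Matrix (Fin 3) (Fin 3) E) = rogawskiPhi E 3 := by
  rw [Matrix.coe_units_inv, hΦ]
  exact Matrix.inv_eq_left_inv (rogawskiPhi_three_mul_self E)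

/-- **`ε(y)⁻¹ = Φ⁻¹ ᵗσ(y) Φ`** as a matrix. [cite: Rogawski1990, §3.10 p. 33 (chunk p0036)] -/
private theorem coe_inv_unitaryTwist (y : GL (Fin 3) E) :
    (((unitaryTwist (σ : E →+* E) Φ y)⁻¹ : GL (Fin 3) E) : Matrix (Fin 3) (Fin 3) E)
      = ((Φ⁻¹ : GL (Fin 3) E) : Matrix (Fin 3) (Fin 3) E) * ((y : Matrix (Fin 3) (Fin 3) E).map (σ : E →+* E))ᵀ *
          (Φ : Matrix (Fin 3) (Fin 3) E) := by
  have h : unitaryTwist (σ : E →+* E) Φ y =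
      Φ⁻¹ * glTransposeInv (Fin 3) E (Matrix.GeneralLinearGroup.map (σ : E →+* E) y) * Φ := rfl
  rw [h, mul_inv_rev, mul_inv_rev, inv_inv, ← mul_assoc, ← map_inv, Units.val_mul, Units.val_mul, coe_glTransposeInv_apply,
    inv_inv, coe_map_sigma_three]

/-- **`ε`-conjugation is `σ`-congruence**: `(y δ ε(y)⁻¹) Φ₃ = y (δ Φ₃) ᵗσ(y)` for `Φ = Φ₃`. [cite: Rogawski1990, §3.10 p. 33 (chunk p0036); §1.4 p. 4] -/
private theorem coe_epsConj_mul_phi (hΦ : (Φ : Matrix (Fin 3) (Fin 3) E) = rogawskiPhi E 3) (y g : GL (Fin 3) E) :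
    ((y * g * (unitaryTwist (σ : E →+* E) Φ y)⁻¹ : GL (Fin 3) E) : Matrix (Fin 3) (Fin 3) E) * rogawskiPhi E 3
      = (y : Matrix (Fin 3) (Fin 3) E) * ((g : Matrix (Fin 3) (Fin 3) E) * rogawskiPhi E 3) *
          ((y : Matrix (Fin 3) (Fin 3) E).map (σ : E →+* E))ᵀ := by
  rw [Units.val_mul, Units.val_mul, coe_inv_unitaryTwist, coe_phi_inv E Φ hΦ, hΦ]
  simp only [Matrix.mul_assoc]
  rw [rogawskiPhi_three_mul_self, Matrix.mul_one]

omit [TopologicalSpace E] in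
/-- Two elements of `GL₃(E)` with `M Φ₃ = M′ Φ₃` (as matrices) are equal. [folklore] -/
private theorem eq_of_val_mul_phi_eq {M N : GL (Fin 3) E}
    (h : (M : Matrix (Fin 3) (Fin 3) E) * rogawskiPhi E 3 = (N : Matrix (Fin 3) (Fin 3) E) * rogawskiPhi E 3) : M = N := by
  refine Units.ext ?_
  have h' := congrArg (fun X => X * rogawskiPhi E 3) h
  simp only [Matrix.mul_assoc, rogawskiPhi_three_mul_self, Matrix.mul_one] at h'
  exact h'

omit [TopologicalSpace E] in
/-- `ᵗσ(A(g)) = Φ₃ ᵗσ(g)` for `A(g) = g Φ₃`. [folklore] -/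
private theorem map_transpose_mul_phi (g : Matrix (Fin 3) (Fin 3) E) :
    ((g * rogawskiPhi E 3).map (σ : E →+* E))ᵀ = rogawskiPhi E 3 * (g.map (σ : E →+* E))ᵀ := by
  rw [Matrix.map_mul, Matrix.transpose_mul, rogawskiPhi_three_map_transpose]

/-- **`N(g) = D` forces `A(g) = D ᵗσ(A(g))`** (`g = N(g) ε(g)⁻¹ = D Φ₃ ᵗσ(g) Φ₃`). [cite: Rogawski1990, §3.10 p. 33; §3.13 p. 38 (chunk p0042)] -/
private theorem val_mul_phi_eq_of_epsNorm_eq (hΦ : (Φ : Matrix (Fin 3) (Fin 3) E) = rogawskiPhi E 3) {g D : GL (Fin 3) E}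
    (hN : epsNorm (unitaryTwist (σ : E →+* E) Φ) g = D) :
    (g : Matrix (Fin 3) (Fin 3) E) * rogawskiPhi E 3 =
      (D : Matrix (Fin 3) (Fin 3) E) * (((g : Matrix (Fin 3) (Fin 3) E) * rogawskiPhi E 3).map (σ : E →+* E))ᵀ := by
  have h1 : g = epsNorm (unitaryTwist (σ : E →+* E) Φ) g * (unitaryTwist (σ : E →+* E) Φ g)⁻¹ := by
    rw [Ch4Sec10.epsNorm, mul_inv_cancel_right]
  have h2 : (g : Matrix (Fin 3) (Fin 3) E) =
      (D : Matrix (Fin 3) (Fin 3) E) * (rogawskiPhi E 3 * ((g : Matrix (Fin 3) (Fin 3) E).map (σ : E →+* E))ᵀ * rogawskiPhi E 3) := by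
    conv_lhs => rw [h1]
    rw [Units.val_mul, hN, coe_inv_unitaryTwist, coe_phi_inv E Φ hΦ, hΦ]
  rw [map_transpose_mul_phi]
  conv_lhs => rw [h2]
  simp only [Matrix.mul_assoc]
  rw [rogawskiPhi_three_mul_self, Matrix.mul_one]

/-- **Conversely `A(g) = D ᵗσ(A(g))` gives `N(g) = D`**. [cite: Rogawski1990, §3.10 p. 33; §3.13 p. 38 (chunk p0042)] -/
private theorem epsNorm_eq_of_val_mul_phi_eq (hΦ : (Φ : Matrix (Fin 3) (Fin 3) E) = rogawskiPhi E 3) {g D : GL (Fin 3) E}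
    (hA : (g : Matrix (Fin 3) (Fin 3) E) * rogawskiPhi E 3 =
      (D : Matrix (Fin 3) (Fin 3) E) * (((g : Matrix (Fin 3) (Fin 3) E) * rogawskiPhi E 3).map (σ : E →+* E))ᵀ) :
    epsNorm (unitaryTwist (σ : E →+* E) Φ) g = D := by
  rw [Ch4Sec10.epsNorm, ← eq_mul_inv_iff_mul_eq]
  refine Units.ext ?_
  have h := congrArg (fun X => X * rogawskiPhi E 3) hA
  simp only [Matrix.mul_assoc, rogawskiPhi_three_mul_self, Matrix.mul_one] at h
  rw [Units.val_mul, coe_inv_unitaryTwist, coe_phi_inv E Φ hΦ, hΦ]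
  conv_lhs => rw [h, map_transpose_mul_phi]

/-- **`N(y g ε(y)⁻¹) = y N(g) y⁻¹`** (`ε ∘ ε = id` for `Φ = Φ₃`, ★ `unitaryTwist_unitaryTwist`). [cite: Rogawski1990, §3.11 p. 34 (chunk p0037)] -/
private theorem epsNorm_epsConj (hσσ : ∀ x : E, σ (σ x) = x) (hΦ : (Φ : Matrix (Fin 3) (Fin 3) E) = rogawskiPhi E 3) (y g : GL (Fin 3) E) :
    epsNorm (unitaryTwist (σ : E →+* E) Φ) (y * g * (unitaryTwist (σ : E →+* E) Φ y)⁻¹) =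
      y * epsNorm (unitaryTwist (σ : E →+* E) Φ) g * y⁻¹ := by
  have hherm : ((Φ : Matrix (Fin 3) (Fin 3) E).map (σ : E →+* E))ᵀ = (Φ : Matrix (Fin 3) (Fin 3) E) := by
    rw [hΦ, rogawskiPhi_three_map_transpose]
  simp only [Ch4Sec10.epsNorm, map_mul, map_inv, unitaryTwist_unitaryTwist F E σ Φ hσσ hherm]
  group

/-- **`N(z g) = N(g)` for `z ∈ F^*`** (`ε(w·1) = (σw)⁻¹·1`, ★ `unitaryTwist_scalar`). [cite: Rogawski1990, §3.11 Prop. 3.11.2 (c) proof p. 36] -/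
private theorem epsNorm_scalar_mul {w : Eˣ} (hw : σ (w : E) = w) (g : GL (Fin 3) E) :
    epsNorm (unitaryTwist (σ : E →+* E) Φ) (Matrix.GeneralLinearGroup.scalar (Fin 3) w * g) =
      epsNorm (unitaryTwist (σ : E →+* E) Φ) g := by
  have hσw : Units.map ((σ : E →+* E) : E →* E) w = w := Units.ext (by rw [Units.coe_map]; exact hw)
  rw [Ch4Sec10.epsNorm, Ch4Sec10.epsNorm, map_mul, unitaryTwist_scalar F E σ Φ w, hσw, scalar_mul_comm E w g, mul_assoc,
    mul_inv_cancel_left]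

end EpsCalculus

/-! ## §3 Hilbert 90 for `E¹` (explicit) and the two LOCAL INPUTS in topology-free form -/

section LocalInputs

variable (F E : Type) [Field F] [Field E] [Algebra F E] (σ : E ≃ₐ[F] E)

/-- **Hilbert 90, explicit**: `c σ(c) = 1 ⇒ c = μ/σ(μ)` with `μ = 1 + c`, or `μ = θ − σθ` (anti-fixed, `≠ 0` since `σ ≠ 1`) when `c = −1`.
[folklore] -/
private theorem exists_ne_zero_eq_mul_sigma (hσσ : ∀ x : E, σ (σ x) = x) (hne : σ ≠ AlgEquiv.refl) {c : E} (hc : c * σ c = 1) :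
    ∃ μ : E, μ ≠ 0 ∧ μ = c * σ μ := by
  by_cases h : c = -1
  · have hθ : ∃ θ : E, σ θ ≠ θ := by
      by_contra h'
      push Not at h'
      exact hne (AlgEquiv.ext h')
    obtain ⟨θ, hθ⟩ := hθ
    refine ⟨θ - σ θ, sub_ne_zero.mpr (Ne.symm hθ), ?_⟩
    rw [map_sub, hσσ, h]
    ring
  · refine ⟨1 + c, fun h0 => h (by linear_combination h0), ?_⟩
    rw [map_add, map_one, mul_add, mul_one, hc]
    ring

/-- **JACOBOWITZ IN RANK 2, topology-free packaging** (★ `UnitaryGroup.nonempty_formCongr_eq_iff_det_two_localField` of B-typ04 through the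
`p`-adic bridge ★ `exists_isNonarchimedeanLocalField_of_isPadicField`): over `E/F` with `F` `p`-adic, two non-degenerate `σ`-hermitian
`G, G′ ∈ M₂(E)` whose discriminants differ by a norm are congruent, `ᵗσ(U) G U = G′`. [cite: Jacobowitz1962, §3 Thm. 3.1]
[cite: Rogawski1990, §3.8 (3.8.1) p. 31] -/
private theorem exists_formCongr_two (hF : IsPadicField F) (hq : IsQuadraticConj F E σ) {G G' : Matrix (Fin 2) (Fin 2) E}
    (hG : (G.map (σ : E →+* E))ᵀ = G) (hGd : G.det ≠ 0) (hG' : (G'.map (σ : E →+* E))ᵀ = G') (hGd' : G'.det ≠ 0)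
    (hz : ∃ z : E, z ≠ 0 ∧ G'.det = σ z * z * G.det) :
    ∃ U : GL (Fin 2) E, formCongr (σ : E →+* E) U G = G' := by
  obtain ⟨hE0, v', τ', h'⟩ := exists_isNonarchimedeanLocalField_of_isPadicField F E σ hF hq
  haveI := hE0
  letI := v'
  letI := τ'
  haveI := h'
  exact (Literature.NumberTheory.Automorphic.UnitaryGroup.nonempty_formCongr_eq_iff_det_two_localField
    (σ := (σ : E →+* E)) (IsQuadraticConj.apply_apply F E σ hq) (ringHom_ne_id_of_isQuadraticConj F E σ hq) hG hGd hG' hGd').2 hz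

end LocalInputs

/-! ## §4 Matrix algebra: the normal form `A = D ᵗσ(A)` with `D = d(α, β, α)`, `α ≠ β`, and the block embedding `GL₂ × GL₁ ⊂ GL₃` -/

section Blocks

variable {E : Type} [Field E] (τ : E →+* E)

/-- Entries of `A = diag(d) · ᵗτ(A)`: `A i j = d i · τ(A j i)`. [folklore] -/
private theorem apply_eq_of_eq_diagonal_mul {A : Matrix (Fin 3) (Fin 3) E} {d : Fin 3 → E}
    (h : A = Matrix.diagonal d * (A.map τ)ᵀ) (i j : Fin 3) : A i j = d i * τ (A j i) := by
  conv_lhs => rw [h]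
  rw [Matrix.diagonal_mul, Matrix.transpose_apply, Matrix.map_apply]

/-- **Block structure**: if `A = d(α, β, α) ᵗτ(A)` with `τ ∘ τ = id`, `α·τ(β) ≠ 1`, `β·τ(α) ≠ 1`, then the entries of `A` linking the
`α`-plane `{0, 2}` and the `β`-line `{1}` vanish. [cite: Rogawski1990, §3.13 Prop. 3.13.2 (proof) p. 38 (chunk p0042)] -/
private theorem offdiag_eq_zero (hττ : ∀ x, τ (τ x) = x) {A : Matrix (Fin 3) (Fin 3) E} {α β : E}
    (h : A = Matrix.diagonal ![α, β, α] * (A.map τ)ᵀ) (hab : α * τ β ≠ 1) (hba : β * τ α ≠ 1) :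
    A 0 1 = 0 ∧ A 1 0 = 0 ∧ A 1 2 = 0 ∧ A 2 1 = 0 := by
  have e := apply_eq_of_eq_diagonal_mul τ h
  have h01 : A 0 1 = α * τ (A 1 0) := by simpa using e 0 1
  have h10 : A 1 0 = β * τ (A 0 1) := by simpa using e 1 0
  have h12 : A 1 2 = β * τ (A 2 1) := by simpa using e 1 2
  have h21 : A 2 1 = α * τ (A 1 2) := by simpa using e 2 1
  have z01 : A 0 1 = 0 := by
    have : (1 - α * τ β) * A 0 1 = 0 := by
      have h' : A 0 1 = α * τ β * A 0 1 := by
        conv_lhs => rw [h01, h10, map_mul, hττ]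
        ring
      linear_combination h'
    rcases mul_eq_zero.1 this with h0 | h0
    · exact absurd (sub_eq_zero.1 h0).symm hab
    · exact h0
  have z12 : A 1 2 = 0 := by
    have : (1 - β * τ α) * A 1 2 = 0 := by
      have h' : A 1 2 = β * τ α * A 1 2 := by
        conv_lhs => rw [h12, h21, map_mul, hττ]
        ring
      linear_combination h'
    rcases mul_eq_zero.1 this with h0 | h0
    · exact absurd (sub_eq_zero.1 h0).symm hba
    · exact h0
  refine ⟨z01, ?_, z12, ?_⟩
  · rw [h10, z01, map_zero, mul_zero]
  · rw [h21, z12, map_zero, mul_zero]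

/-- **The hermitian block**: with `p = ατ(p)`, `q = ατ(r)`, `r = ατ(q)`, `s = ατ(s)` and `μ = ατ(μ) ≠ 0`, the matrix `μ⁻¹ · [[p,q],[r,s]]` is
`τ`-hermitian. [folklore] -/
private theorem block_hermitian {α μ p q r s : E} (hα : α ≠ 0) (hμ0 : μ ≠ 0) (hμ : μ = α * τ μ)
    (hp : p = α * τ p) (hq : q = α * τ r) (hr : r = α * τ q) (hs : s = α * τ s) :
    ((!![μ⁻¹ * p, μ⁻¹ * q; μ⁻¹ * r, μ⁻¹ * s] : Matrix (Fin 2) (Fin 2) E).map τ)ᵀ = !![μ⁻¹ * p, μ⁻¹ * q; μ⁻¹ * r, μ⁻¹ * s] := by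
  have hτμ : τ μ = μ * α⁻¹ := by
    rw [eq_mul_inv_iff_mul_eq₀ hα, mul_comm]; exact hμ.symm
  have hτμ0 : τ μ ≠ 0 := (map_ne_zero τ).2 hμ0
  have hτp : τ p = p * α⁻¹ := by rw [eq_mul_inv_iff_mul_eq₀ hα, mul_comm]; exact hp.symm
  have hτs : τ s = s * α⁻¹ := by rw [eq_mul_inv_iff_mul_eq₀ hα, mul_comm]; exact hs.symm
  have hτr : τ r = q * α⁻¹ := by rw [eq_mul_inv_iff_mul_eq₀ hα, mul_comm]; exact hq.symm
  have hτq : τ q = r * α⁻¹ := by rw [eq_mul_inv_iff_mul_eq₀ hα, mul_comm]; exact hr.symm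
  ext i j
  fin_cases i <;> fin_cases j <;> simp [map_inv₀, hτμ, hτp, hτq, hτr, hτs] <;> field_simp

/-- **Block multiplication**: `y = Y ⊕ w` on `{0,2} ⊕ {1}` and `A = B ⊕ m` give `y A ᵗτ(y) = (Y B ᵗτ(Y)) ⊕ (w m τ(w))`. [folklore] -/
private theorem block_congr (Y B : Matrix (Fin 2) (Fin 2) E) (w m : E) :
    (!![Y 0 0, 0, Y 0 1; 0, w, 0; Y 1 0, 0, Y 1 1] : Matrix (Fin 3) (Fin 3) E) * !![B 0 0, 0, B 0 1; 0, m, 0; B 1 0, 0, B 1 1] *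
        ((!![Y 0 0, 0, Y 0 1; 0, w, 0; Y 1 0, 0, Y 1 1] : Matrix (Fin 3) (Fin 3) E).map τ)ᵀ =
      !![(Y * B * (Y.map τ)ᵀ) 0 0, 0, (Y * B * (Y.map τ)ᵀ) 0 1; 0, w * m * τ w, 0;
        (Y * B * (Y.map τ)ᵀ) 1 0, 0, (Y * B * (Y.map τ)ᵀ) 1 1] := by
  ext i j
  fin_cases i <;> fin_cases j <;> simp [Matrix.mul_apply, Fin.sum_univ_three, Fin.sum_univ_two]

omit τ in
/-- `det(Y ⊕ w) = det(Y) · w`. [folklore] -/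
private theorem det_block (Y : Matrix (Fin 2) (Fin 2) E) (w : E) :
    ((!![Y 0 0, 0, Y 0 1; 0, w, 0; Y 1 0, 0, Y 1 1] : Matrix (Fin 3) (Fin 3) E)).det = Y.det * w := by
  rw [Matrix.det_fin_three, Matrix.det_fin_two]
  simp
  ring

/-- The `(1,1)` entry of `y A ᵗτ(y)` when row `1` of `y` is `(0, y₁₁, 0)`. [folklore] -/
private theorem congr_apply_one_one {y A : Matrix (Fin 3) (Fin 3) E} (h10 : y 1 0 = 0) (h12 : y 1 2 = 0) :
    (y * A * (y.map τ)ᵀ) 1 1 = y 1 1 * A 1 1 * τ (y 1 1) := by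
  simp [Matrix.mul_apply, Fin.sum_univ_three, h10, h12]

omit τ in
/-- A matrix commuting with `d(α, β, α)`, `α ≠ β`, has row `1` equal to `(0, y₁₁, 0)`. [folklore] -/
private theorem row_one_of_comm_diagonal {y : Matrix (Fin 3) (Fin 3) E} {α β : E} (hαβ : α ≠ β)
    (h : y * Matrix.diagonal ![α, β, α] = Matrix.diagonal ![α, β, α] * y) : y 1 0 = 0 ∧ y 1 2 = 0 := by
  have h10 := congrFun (congrFun h 1) 0
  have h12 := congrFun (congrFun h 1) 2
  simp [Matrix.mul_diagonal, Matrix.diagonal_mul] at h10 h12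
  have hβα : β - α ≠ 0 := sub_ne_zero.2 (Ne.symm hαβ)
  constructor
  · have : (β - α) * y 1 0 = 0 := by linear_combination -h10
    exact (mul_eq_zero.1 this).resolve_left hβα
  · have : (β - α) * y 1 2 = 0 := by linear_combination -h12
    exact (mul_eq_zero.1 this).resolve_left hβα

/-- `det(y A ᵗτ(y)) = det(y) · det(A) · τ(det y)`. [folklore] -/
private theorem det_congr (y A : Matrix (Fin 3) (Fin 3) E) :
    (y * A * (y.map τ)ᵀ).det = y.det * A.det * τ y.det := by
  rw [Matrix.det_mul, Matrix.det_mul, Matrix.det_transpose, ← RingHom.mapMatrix_apply, ← RingHom.map_det]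

omit τ in
/-- The REPRESENTATIVE matrices `R(x) = !![0, 0, μ; 0, −ν, 0; μx, 0, 0]`: `R(x) Φ₃ = d(μ, ν, μx)`. [folklore] -/
private theorem repMat_mul_phi (μ ν x : E) :
    (!![0, 0, μ; 0, -ν, 0; μ * x, 0, 0] : Matrix (Fin 3) (Fin 3) E) * rogawskiPhi E 3 = Matrix.diagonal ![μ, ν, μ * x] := by
  rw [rogawskiPhi_three]
  ext i j
  fin_cases i <;> fin_cases j <;> simp [Matrix.mul_apply, Fin.sum_univ_three, Matrix.diagonal]

omit τ in
/-- `det R(x) = μ² ν x`. [folklore] -/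
private theorem det_repMat (μ ν x : E) :
    ((!![0, 0, μ; 0, -ν, 0; μ * x, 0, 0] : Matrix (Fin 3) (Fin 3) E)).det = μ * μ * ν * x := by
  rw [Matrix.det_fin_three]
  simp
  ring

/-- `d(μ, ν, μx) = d(α, β, α) ᵗτ(d(μ, ν, μx))` when `μ = ατ(μ)`, `ν = βτ(ν)`, `τ x = x`. [folklore] -/
private theorem diag_rep_eq (α β : E) {μ ν x : E} (hμ : μ = α * τ μ) (hν : ν = β * τ ν) (hx : τ x = x) :
    Matrix.diagonal ![μ, ν, μ * x] = Matrix.diagonal ![α, β, α] * ((Matrix.diagonal ![μ, ν, μ * x]).map τ)ᵀ := by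
  rw [Matrix.diagonal_map (map_zero τ), Matrix.diagonal_transpose, Matrix.diagonal_mul_diagonal]
  congr 1
  funext i
  fin_cases i
  · simpa using hμ
  · simpa using hν
  · simp [map_mul, hx]
    linear_combination x * hμ

end Blocks

/-! ## §5 PROPOSITION 3.13.2 (a), `F` `p`-adic: the discharge of ★ `prop3132aPadic` -/

section Main

variable (F E : Type) [Field F] [Field E] [Algebra F E] [TopologicalSpace E] (σ : E ≃ₐ[F] E) (Φ : GL (Fin 3) E)

/-- **PROPOSITION 3.13.2 (a), `F` `p`-adic, PROVED**: ★ `prop3132aPadic` holds — for `F` `p`-adic, `Φ = Φ₃` and `δ ∈ GL₃(E)`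
`ε`-semisimple, not `ε`-regular, with `N(δ)` not central, the stable `ε`-class of `δ` consists of exactly TWO `ε`-classes modulo
`F^*` («`𝒟_ε(δ/F)` is naturally isomorphic to `F^*/NE^*`»).  In the tree's currency: `N(δ) ∼ D = d(α, β, α)`, `α ≠ β` in `E¹`
(★ `prop3132_holds`); every member is `ε`-conjugate to a `δ₁` with `N(δ₁) = D`, whose `A(δ₁) = δ₁Φ₃ = D ᵗσ(A)` is `μH₂ ⊕ νh₁` with `H₂`
a non-degenerate hermitian PLANE and `h₁ ∈ F^*` (`α = μ/σμ`, `β = ν/σν`); modulo `F^*` the class is the discriminant of `H₂` in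
`F^*/NE^* ≅ ℤ/2` (Jacobowitz in rank 2, ★ B-typ04's `nonempty_formCongr_eq_iff_det_two_localField`, and `[F^* : NE^*] = 2`, ★
`Ch3Sec10to13PadicBridge`); representatives `R(1) = d(μ,ν,μ)Φ₃` and `R(t₀) = d(μ,ν,μt₀)Φ₃`, `t₀ ∉ NE^*`.
[cite: Rogawski1990, §3.13 Prop. 3.13.2 (a) p. 38 (chunk p0042); §3.8 (3.8.1) p. 31 (chunk p0034)] -/
theorem prop3132aPadic_holds : prop3132aPadic F E σ Φ := by
  intro hSt hΦ hF δ hss hnreg hnc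
  classical
  have hq : IsQuadraticConj F E σ := hSt.2.1
  have hσσ : ∀ x : E, σ (σ x) = x := IsQuadraticConj.apply_apply F E σ hq
  have hne : σ ≠ AlgEquiv.refl := hq.2
  /- §0 the diagonal member `d = d(a, b, a)` of the stable `ε`-class and `D = N(d) = d(α, β, α)` -/
  obtain ⟨d, a, b, hd, hstd⟩ := prop3132_holds F E σ Φ hSt hΦ δ hss hnreg
  have hstdD : IsConj (epsNorm (unitaryTwist (σ : E →+* E) Φ) δ) (epsNorm (unitaryTwist (σ : E →+* E) Φ) d) := hstd
  have hdet_d : (d : Matrix (Fin 3) (Fin 3) E).det = a * b * a := by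
    rw [hd, Matrix.det_diagonal, Fin.prod_univ_three]
    simp
  have hab0 : a * b * a ≠ 0 := hdet_d ▸ (Matrix.isUnits_det_units d).ne_zero
  have ha : a ≠ 0 := fun h => hab0 (by rw [h, zero_mul, zero_mul])
  have hb : b ≠ 0 := fun h => hab0 (by rw [h, mul_zero, zero_mul])
  have hσa : σ a ≠ 0 := (map_ne_zero σ).2 ha
  have hσb : σ b ≠ 0 := (map_ne_zero σ).2 hb
  set α : E := a * (σ a)⁻¹ with hαdef
  set β : E := b * (σ b)⁻¹ with hβdef
  set Dg : GL (Fin 3) E := epsNorm (unitaryTwist (σ : E →+* E) Φ) d with hDg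
  have hDmat : (Dg : Matrix (Fin 3) (Fin 3) E) = Matrix.diagonal ![α, β, α] := coe_epsNorm_diag F E σ Φ hΦ ha hb d hd
  have hα1 : α * σ α = 1 := by rw [hαdef, map_mul, map_inv₀, hσσ]; field_simp
  have hβ1 : β * σ β = 1 := by rw [hβdef, map_mul, map_inv₀, hσσ]; field_simp
  have hα0 : α ≠ 0 := mul_ne_zero ha (inv_ne_zero hσa)
  have hβ0 : β ≠ 0 := mul_ne_zero hb (inv_ne_zero hσb)
  -- `N(δ)` is not central, so `α ≠ β`
  have hαβ : α ≠ β := by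
    intro h
    apply hnc
    obtain ⟨c, hc⟩ := isConj_iff.1 hstdD
    have hDs : Dg = Matrix.GeneralLinearGroup.scalar (Fin 3) (Units.mk0 α hα0) := by
      refine Units.ext ?_
      rw [hDmat, coe_scalar_three, Units.val_mk0, ← h]
      ext i j
      fin_cases i <;> fin_cases j <;> simp [Matrix.diagonal]
    have hN : epsNorm (unitaryTwist (σ : E →+* E) Φ) δ = Dg := by
      have h1 : epsNorm (unitaryTwist (σ : E →+* E) Φ) δ = c⁻¹ * Dg * c := by rw [← hc]; group
      rw [h1, hDs, mul_assoc, scalar_mul_comm E _ c, ← mul_assoc, inv_mul_cancel, one_mul]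
    rw [hN, hDs, Matrix.GeneralLinearGroup.center_eq_range_scalar]
    exact ⟨_, rfl⟩
  have hab : α * σ β ≠ 1 := by
    intro h
    apply hαβ
    have hσβ0 : σ β ≠ 0 := (map_ne_zero σ).2 hβ0
    exact mul_right_cancel₀ hσβ0 (h.trans hβ1.symm)
  have hba : β * σ α ≠ 1 := by
    intro h
    apply hαβ
    have hσα0 : σ α ≠ 0 := (map_ne_zero σ).2 hα0
    exact (mul_right_cancel₀ hσα0 (h.trans hα1.symm)).symm
  /- Hilbert 90 scalars `α = μ/σμ`, `β = ν/σν`, and the local inputs -/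
  obtain ⟨μ, hμ0, hμ⟩ := exists_ne_zero_eq_mul_sigma F E σ hσσ hne hα1
  obtain ⟨ν, hν0, hν⟩ := exists_ne_zero_eq_mul_sigma F E σ hσσ hne hβ1
  obtain ⟨t₀, hσt₀, ht₀, htn, hdich⟩ := exists_fixed_nonnorm_dichotomy_of_isPadicField F E σ hF hq
  /- the representatives `R(1)`, `R(t₀)` -/
  have hdet1 : ((!![0, 0, μ; 0, -ν, 0; μ * 1, 0, 0] : Matrix (Fin 3) (Fin 3) E)).det ≠ 0 := by
    rw [det_repMat]; exact mul_ne_zero (mul_ne_zero (mul_ne_zero hμ0 hμ0) hν0) one_ne_zero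
  have hdet2 : ((!![0, 0, μ; 0, -ν, 0; μ * t₀, 0, 0] : Matrix (Fin 3) (Fin 3) E)).det ≠ 0 := by
    rw [det_repMat]; exact mul_ne_zero (mul_ne_zero (mul_ne_zero hμ0 hμ0) hν0) ht₀
  set g₁ : GL (Fin 3) E := Matrix.GeneralLinearGroup.mkOfDetNeZero _ hdet1 with hg₁def
  set g₂ : GL (Fin 3) E := Matrix.GeneralLinearGroup.mkOfDetNeZero _ hdet2 with hg₂def
  have hA₁ : (g₁ : Matrix (Fin 3) (Fin 3) E) * rogawskiPhi E 3 = Matrix.diagonal ![μ, ν, μ * 1] := repMat_mul_phi μ ν 1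
  have hA₂ : (g₂ : Matrix (Fin 3) (Fin 3) E) * rogawskiPhi E 3 = Matrix.diagonal ![μ, ν, μ * t₀] := repMat_mul_phi μ ν t₀
  have hN₁ : epsNorm (unitaryTwist (σ : E →+* E) Φ) g₁ = Dg :=
    epsNorm_eq_of_val_mul_phi_eq F E σ Φ hΦ (by
      rw [hA₁, hDmat]; exact diag_rep_eq (σ : E →+* E) α β hμ hν (map_one _))
  have hN₂ : epsNorm (unitaryTwist (σ : E →+* E) Φ) g₂ = Dg :=
    epsNorm_eq_of_val_mul_phi_eq F E σ Φ hΦ (by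
      rw [hA₂, hDmat]; exact diag_rep_eq (σ : E →+* E) α β hμ hν hσt₀)
  refine ⟨g₁, g₂, ?_, ?_, ?_, ?_⟩
  · show IsConj _ _
    rw [hN₁]; exact hstdD
  · show IsConj _ _
    rw [hN₂]; exact hstdD
  · /- `R(1)` and `R(t₀)` are NOT `ε`-conjugate modulo `F^*`: the `β`-line eats one factor `w = N(y₁₁)`, and the determinant then
      makes `t₀` a norm -/
    rintro ⟨z, hz, y, hy⟩
    obtain ⟨w, hw, rfl⟩ := hz
    have hw' : Units.map ((σ : E →+* E) : E →* E) w = w := hw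
    have hσw : σ (w : E) = w := by simpa using congrArg Units.val hw'
    rw [show (Units.map ((Matrix.scalar (Fin 3) : E →+* Matrix (Fin 3) (Fin 3) E) : E →* Matrix (Fin 3) (Fin 3) E) w : GL (Fin 3) E)
        = Matrix.GeneralLinearGroup.scalar (Fin 3) w from rfl] at hy
    -- (B) `y` commutes with `D`
    have hcomm : (y : Matrix (Fin 3) (Fin 3) E) * Matrix.diagonal ![α, β, α] = Matrix.diagonal ![α, β, α] * (y : Matrix (Fin 3) (Fin 3) E) := by
      have h1 := epsNorm_epsConj F E σ Φ hσσ hΦ y g₁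
      rw [hy, epsNorm_scalar_mul F E σ Φ hσw g₂, hN₁, hN₂] at h1
      -- h1 : Dg = y * Dg * y⁻¹
      have h2 : Dg * y = y * Dg := by
        calc Dg * y = y * Dg * y⁻¹ * y := by rw [← h1]
          _ = y * Dg := by group
      have h3 := congrArg (fun M : GL (Fin 3) E => (M : Matrix (Fin 3) (Fin 3) E)) h2
      simp only [Units.val_mul, hDmat] at h3
      exact h3.symm
    obtain ⟨hy10, hy12⟩ := row_one_of_comm_diagonal hαβ hcomm
    -- (A) the congruence identity `y A₁ ᵗσ(y) = w • A₂`
    have key := congrArg (fun M : GL (Fin 3) E => (M : Matrix (Fin 3) (Fin 3) E) * rogawskiPhi E 3) hy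
    beta_reduce at key
    rw [coe_epsConj_mul_phi F E σ Φ hΦ, hA₁, Units.val_mul, coe_scalar_three, Matrix.smul_mul, Matrix.one_mul, Matrix.smul_mul,
      hA₂] at key
    -- (C) the `(1,1)` entry: `y₁₁ ν σ(y₁₁) = w ν`
    have h11 := congrFun (congrFun key 1) 1
    rw [congr_apply_one_one (σ : E →+* E) hy10 hy12] at h11
    simp [Matrix.diagonal] at h11
    have e1 : (y : Matrix (Fin 3) (Fin 3) E) 1 1 * σ ((y : Matrix (Fin 3) (Fin 3) E) 1 1) = w := by
      have : ν * ((y : Matrix (Fin 3) (Fin 3) E) 1 1 * σ ((y : Matrix (Fin 3) (Fin 3) E) 1 1) - w) = 0 := by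
        linear_combination h11
      exact sub_eq_zero.1 ((mul_eq_zero.1 this).resolve_left hν0)
    have hy11 : (y : Matrix (Fin 3) (Fin 3) E) 1 1 ≠ 0 := by
      intro h0; rw [h0, zero_mul] at e1; exact Units.ne_zero w e1.symm
    -- (D) determinants: `N(det y) μ²ν = w³ μ²ν t₀`
    have hdet := congrArg Matrix.det key
    rw [det_congr, Matrix.det_smul, Matrix.det_diagonal, Matrix.det_diagonal, Fin.prod_univ_three, Fin.prod_univ_three,
      Fintype.card_fin] at hdet
    simp at hdet
    have e2 : (y : Matrix (Fin 3) (Fin 3) E).det * σ ((y : Matrix (Fin 3) (Fin 3) E).det) = (w : E) ^ 3 * t₀ := by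
      have : μ * (ν * μ) * ((y : Matrix (Fin 3) (Fin 3) E).det * σ ((y : Matrix (Fin 3) (Fin 3) E).det) - (w : E) ^ 3 * t₀) = 0 := by
        linear_combination hdet
      exact sub_eq_zero.1 ((mul_eq_zero.1 this).resolve_left (mul_ne_zero hμ0 (mul_ne_zero hν0 hμ0)))
    -- `t₀ = N(det y / y₁₁³)`
    refine htn ((y : Matrix (Fin 3) (Fin 3) E).det / (y : Matrix (Fin 3) (Fin 3) E) 1 1 ^ 3) ?_
    have hσy11 : σ ((y : Matrix (Fin 3) (Fin 3) E) 1 1) ≠ 0 := (map_ne_zero σ).2 hy11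
    rw [map_div₀, map_pow]
    field_simp
    linear_combination e2 - t₀ * (((y : Matrix (Fin 3) (Fin 3) E) 1 1 * σ ((y : Matrix (Fin 3) (Fin 3) E) 1 1)) ^ 2
      + ((y : Matrix (Fin 3) (Fin 3) E) 1 1 * σ ((y : Matrix (Fin 3) (Fin 3) E) 1 1)) * w + (w : E) ^ 2) * e1
  · /- EXHAUSTION: every member of the stable `ε`-class is `ε`-conjugate modulo `F^*` to `R(1)` or to `R(t₀)` -/
    intro δ' hst'
    have hst'' : IsConj (epsNorm (unitaryTwist (σ : E →+* E) Φ) δ) (epsNorm (unitaryTwist (σ : E →+* E) Φ) δ') := hst'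
    obtain ⟨c, hc⟩ := isConj_iff.1 (hst''.symm.trans hstdD)
    -- normal form `δ₁ = c δ′ ε(c)⁻¹` with `N(δ₁) = D`
    set δ₁ : GL (Fin 3) E := c * δ' * (unitaryTwist (σ : E →+* E) Φ c)⁻¹ with hδ₁
    have hN' : epsNorm (unitaryTwist (σ : E →+* E) Φ) δ₁ = Dg := by
      rw [hδ₁, epsNorm_epsConj F E σ Φ hσσ hΦ, hc]
    have hA := val_mul_phi_eq_of_epsNorm_eq F E σ Φ hΦ hN'
    rw [hDmat] at hA
    set A : Matrix (Fin 3) (Fin 3) E := (δ₁ : Matrix (Fin 3) (Fin 3) E) * rogawskiPhi E 3 with hAdef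
    have e := apply_eq_of_eq_diagonal_mul (σ : E →+* E) hA
    obtain ⟨z01, z10, z12, z21⟩ := offdiag_eq_zero (σ : E →+* E) hσσ hA hab hba
    have hp : A 0 0 = α * σ (A 0 0) := by simpa using e 0 0
    have hqq : A 0 2 = α * σ (A 2 0) := by simpa using e 0 2
    have hr : A 2 0 = α * σ (A 0 2) := by simpa using e 2 0
    have hs : A 2 2 = α * σ (A 2 2) := by simpa using e 2 2
    have hm : A 1 1 = β * σ (A 1 1) := by simpa using e 1 1
    have hAblock : A = !![A 0 0, 0, A 0 2; 0, A 1 1, 0; A 2 0, 0, A 2 2] := by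
      ext i j
      fin_cases i <;> fin_cases j <;> simp [z01, z10, z12, z21]
    have hdetA : A.det = A 1 1 * (A 0 0 * A 2 2 - A 0 2 * A 2 0) := by
      rw [hAblock, Matrix.det_fin_three]
      simp
      ring
    have hdetA0 : A.det ≠ 0 := by
      rw [hAdef, Matrix.det_mul]
      exact mul_ne_zero (Matrix.isUnits_det_units δ₁).ne_zero (isUnit_det_rogawskiPhi_three E).ne_zero
    have hm0 : A 1 1 ≠ 0 := fun h => hdetA0 (by rw [hdetA, h, zero_mul])
    have hblk0 : A 0 0 * A 2 2 - A 0 2 * A 2 0 ≠ 0 := fun h => hdetA0 (by rw [hdetA, h, mul_zero])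
    -- the hermitian plane `H₂ = μ⁻¹ · (α-block)` and the fixed scalar `h₁ = ν⁻¹ A₁₁`
    set H₂ : Matrix (Fin 2) (Fin 2) E := !![μ⁻¹ * A 0 0, μ⁻¹ * A 0 2; μ⁻¹ * A 2 0, μ⁻¹ * A 2 2] with hH₂
    have hH₂h : (H₂.map (σ : E →+* E))ᵀ = H₂ := block_hermitian (σ : E →+* E) hα0 hμ0 hμ hp hqq hr hs
    have hdetH₂ : H₂.det = μ⁻¹ * μ⁻¹ * (A 0 0 * A 2 2 - A 0 2 * A 2 0) := by
      rw [hH₂, Matrix.det_fin_two_of]; ring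
    have hdetH₂0 : H₂.det ≠ 0 := by
      rw [hdetH₂]; exact mul_ne_zero (mul_ne_zero (inv_ne_zero hμ0) (inv_ne_zero hμ0)) hblk0
    have hσdet : σ H₂.det = H₂.det := by
      have h1 := congrArg Matrix.det hH₂h
      rw [Matrix.det_transpose, ← RingHom.mapMatrix_apply, ← RingHom.map_det] at h1
      exact h1
    set h₁ : E := ν⁻¹ * A 1 1 with hh₁
    have hσh₁ : σ h₁ = h₁ := by
      have hσν : σ ν = ν * β⁻¹ := by rw [eq_mul_inv_iff_mul_eq₀ hβ0, mul_comm]; exact hν.symm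
      have hσm : σ (A 1 1) = A 1 1 * β⁻¹ := by rw [eq_mul_inv_iff_mul_eq₀ hβ0, mul_comm]; exact hm.symm
      rw [hh₁, map_mul, map_inv₀, hσν, hσm]
      field_simp
    have hh₁0 : h₁ ≠ 0 := mul_ne_zero (inv_ne_zero hν0) hm0
    have hm_eq : A 1 1 = ν * h₁ := by rw [hh₁, mul_inv_cancel_left₀ hν0]
    -- the common final step, for a representative `R(x)` whose plane `h₁ • d(1, x)` has the discriminant class of `H₂`
    have finish : ∀ (x : E), σ x = x → x ≠ 0 → ∀ gx : GL (Fin 3) E,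
        (gx : Matrix (Fin 3) (Fin 3) E) * rogawskiPhi E 3 = Matrix.diagonal ![μ, ν, μ * x] →
        (∃ zz : E, zz ≠ 0 ∧ (h₁ • Matrix.diagonal ![(1 : E), x]).det = σ zz * zz * H₂.det) →
        IsEpsConjModF F E σ Φ δ' gx := by
      intro x hx hx0 gx hgx hz
      have hG'h : ((h₁ • Matrix.diagonal ![(1 : E), x]).map (σ : E →+* E))ᵀ = h₁ • Matrix.diagonal ![(1 : E), x] := by
        ext i j
        fin_cases i <;> fin_cases j <;> simp [Matrix.diagonal, hσh₁, hx]
      have hG'd : (h₁ • Matrix.diagonal ![(1 : E), x]).det ≠ 0 := by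
        rw [Matrix.det_smul, Matrix.det_diagonal, Fin.prod_univ_two, Fintype.card_fin]
        simp [hh₁0, hx0]
      obtain ⟨U, hU⟩ := exists_formCongr_two F E σ hF hq hH₂h hdetH₂0 hG'h hG'd hz
      set Y : Matrix (Fin 2) (Fin 2) E := ((U : Matrix (Fin 2) (Fin 2) E).map (σ : E →+* E))ᵀ with hY
      have hYt : (Y.map (σ : E →+* E))ᵀ = (U : Matrix (Fin 2) (Fin 2) E) := by
        rw [hY]
        ext i j
        simp [hσσ]
      have hYH : Y * H₂ * (Y.map (σ : E →+* E))ᵀ = h₁ • Matrix.diagonal ![(1 : E), x] := by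
        rw [hYt, hY]; exact hU
      have hdetY : Y.det ≠ 0 := by
        rw [hY, Matrix.det_transpose, ← RingHom.mapMatrix_apply, ← RingHom.map_det]
        exact (map_ne_zero _).2 (Matrix.isUnits_det_units U).ne_zero
      set y3 : Matrix (Fin 3) (Fin 3) E := !![Y 0 0, 0, Y 0 1; 0, 1, 0; Y 1 0, 0, Y 1 1] with hy3
      have hdety3 : y3.det ≠ 0 := by rw [hy3, det_block, mul_one]; exact hdetY
      set y : GL (Fin 3) E := Matrix.GeneralLinearGroup.mkOfDetNeZero y3 hdety3 with hydef
      have hyval : (y : Matrix (Fin 3) (Fin 3) E) = y3 := rfl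
      -- the block identity `y A ᵗσ(y) = h₁ • d(μ, ν, μx)`
      have hblock : y3 * A * (y3.map (σ : E →+* E))ᵀ = h₁ • Matrix.diagonal ![μ, ν, μ * x] := by
        have hB : A = !![(μ • H₂) 0 0, 0, (μ • H₂) 0 1; 0, A 1 1, 0; (μ • H₂) 1 0, 0, (μ • H₂) 1 1] := by
          rw [hAblock]
          ext i j
          fin_cases i <;> fin_cases j <;> simp [hH₂, mul_inv_cancel_left₀ hμ0]
        rw [hB, hy3, block_congr (σ : E →+* E) Y (μ • H₂) 1 (A 1 1)]
        have h2 : Y * (μ • H₂) * (Y.map (σ : E →+* E))ᵀ = (μ * h₁) • Matrix.diagonal ![(1 : E), x] := by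
          rw [Matrix.mul_smul, Matrix.smul_mul, hYH, smul_smul]
        rw [h2, hm_eq, map_one]
        ext i j
        fin_cases i <;> fin_cases j <;> simp [Matrix.diagonal] <;> ring
      -- hence `y δ₁ ε(y)⁻¹ = (h₁ · 1) R(x)`
      set zu : Eˣ := Units.mk0 h₁ hh₁0 with hzu
      have hzmem : Matrix.GeneralLinearGroup.scalar (Fin 3) zu ∈ fixedScalarSubgroup (σ : E →+* E) :=
        scalar_mem_fixedScalarSubgroup E (σ : E →+* E) (by rw [hzu, Units.val_mk0]; exact hσh₁)
      have hconj1 : y * δ₁ * (unitaryTwist (σ : E →+* E) Φ y)⁻¹ = Matrix.GeneralLinearGroup.scalar (Fin 3) zu * gx := by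
        refine eq_of_val_mul_phi_eq (E := E) ?_
        rw [coe_epsConj_mul_phi F E σ Φ hΦ, hyval, ← hAdef, hblock, Units.val_mul, coe_scalar_three, Matrix.smul_mul,
          Matrix.one_mul, Matrix.smul_mul, hgx, hzu, Units.val_mk0]
      refine ⟨Matrix.GeneralLinearGroup.scalar (Fin 3) zu, hzmem, y * c, ?_⟩
      rw [← hconj1, hδ₁, map_mul, mul_inv_rev]
      group
    rcases hdich H₂.det hσdet hdetH₂0 with ⟨s₁, hs₁⟩ | ⟨s₁, hs₁⟩
    · -- the discriminant of `H₂` is a NORM: class of `R(1)`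
      left
      have hs₁0 : s₁ ≠ 0 := by rintro rfl; rw [zero_mul] at hs₁; exact hdetH₂0 hs₁.symm
      have hσs₁0 : σ s₁ ≠ 0 := (map_ne_zero σ).2 hs₁0
      refine finish 1 (map_one _) one_ne_zero g₁ hA₁ ⟨h₁ * s₁⁻¹, mul_ne_zero hh₁0 (inv_ne_zero hs₁0), ?_⟩
      rw [Matrix.det_smul, Matrix.det_diagonal, Fin.prod_univ_two, Fintype.card_fin, map_mul, map_inv₀, hσh₁, ← hs₁]
      simp
      field_simp
    · -- the discriminant lies in `t₀ · N`: class of `R(t₀)`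
      right
      have hs₁0 : s₁ ≠ 0 := by rintro rfl; rw [zero_mul] at hs₁; exact (mul_ne_zero ht₀ hdetH₂0) hs₁.symm
      have hσs₁0 : σ s₁ ≠ 0 := (map_ne_zero σ).2 hs₁0
      refine finish t₀ hσt₀ ht₀ g₂ hA₂ ⟨h₁ * t₀ * s₁⁻¹, mul_ne_zero (mul_ne_zero hh₁0 ht₀) (inv_ne_zero hs₁0), ?_⟩
      rw [Matrix.det_smul, Matrix.det_diagonal, Fin.prod_univ_two, Fintype.card_fin, map_mul, map_mul, map_inv₀, hσh₁, hσt₀]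
      simp
      have hr : H₂.det = s₁ * σ s₁ / t₀ := by rw [hs₁]; field_simp
      rw [hr]
      field_simp

end Main

end Literature.NumberTheory.Rogawski1990.Ch3Sec10to13

end
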